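import Literature.Geometry.Symplectic.SphereOpenBook
import HarnessLib

/-!
# The positive Hopf open book of `S³`: binding the Hopf link `{z₁ z₂ = 0}`, fibration
# `π = z₁z₂/‖z₁z₂‖`, pages open annuli

Topic `Literature/Geometry/Symplectic`.  A second inhabitant of the tree's open-book interface
`OpenBook` (`PlanarContactBoundary.lean`), after the standard disc open book of `S³`
(`SphereOpenBook*.lean`, whose coordinates `pr₁`, `pr₂`, `join`, tube `tube (p, w) = (w, p)/√(1+‖w‖²)`
and criteria are reused here): the **positive Hopf open book** of the unit sphere `S³ ⊂ ℂ²`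
(Etnyre 2006, §2, Example following Def. 2.1 / the Milnor fibration of `f(z₁, z₂) = z₁z₂`:
binding the positive Hopf link `H = {z₁ = 0} ∪ {z₂ = 0}`, fibration
`π_H(z₁, z₂) = z₁z₂/|z₁z₂|`, pages the open annuli `{arg(z₁z₂) = c}`, monodromy a right-handed
Dehn twist about the core of the annulus).

* `HopfOpenBook.cIso : ℝ² ≃ₗᵢ ℂ` and the complex product `hmul x = z₁(x) z₂(x)` of the two
  complex coordinates of `x ∈ ℝ⁴ = ℂ²`, `mvec = cIso⁻¹ ∘ hmul`;
* the twist `(p, w) ↦ (p, w p̄)` of `S¹ × ℝ²` and the two binding tubes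
  `tube₁ (p, w) = (w p̄, p)/√(1+‖w‖²)` (around `{z₁ = 0}`) and `tube₂ (p, w) = (p, w p̄)/√(1+‖w‖²)`
  (around `{z₂ = 0}`), smooth embeddings with open ranges `{z₂ ≠ 0}`, `{z₁ ≠ 0}`, in which the
  fibration takes the normal form `π (tubeᵢ (p, w)) = w/‖w‖` (`z₁z₂ = w/(1+‖w‖²)` on both);
* `HopfOpenBook.proj z = z₁z₂/‖z₁z₂‖`, smooth off the Hopf link with nowhere-zero angular
  differential (value `1` on the rotation vector `(iz₁, 0)`);
* **`HopfOpenBook.hopfOpenBook : OpenBook S³`**.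

Everything is proved; no named facts.  Used by `HopfPageSystem.lean` (a page system by the
annulus `SmoothPlanarPage 1` for this open book) and by
`Topology/FourManifolds/PlanarLefschetzBodyCounterexample.lean`.

## References

* J. B. Etnyre, *Lectures on open book decompositions and contact structures*, Clay Math. Proc. 5
  (2006), §2 (Def. 2.1 and the examples `H⁺`, Milnor fibrations) (arXiv:math/0409402). [Etnyre2006]
* J. Milnor, *Singular points of complex hypersurfaces*, Ann. of Math. Studies 61 (1968), §1.
  [Milnor1968]
-/

noncomputable section

open scoped Manifold ContDiff Topology RealInnerProductSpace ComplexConjugate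
open Set Function

namespace Literature.Geometry.Symplectic

namespace HopfOpenBook

open Literature.Topology.FourManifolds SphereOpenBook

/-- Local notation: `ℝ⁴ = ℂ²`. -/
local notation "E4" => EuclideanSpace ℝ (Fin 4)
/-- Local notation: `ℝ³` (the chart model of `S³`). -/
local notation "E3" => EuclideanSpace ℝ (Fin 3)
/-- Local notation: `ℝ² = ℂ`. -/
local notation "E2" => EuclideanSpace ℝ (Fin 2)
/-- Local notation: `ℝ¹` (the chart model of `S¹`). -/
local notation "E1" => EuclideanSpace ℝ (Fin 1)
/-- Local notation: the unit sphere `S³ ⊂ ℂ²`. -/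
local notation "S3" => (Metric.sphere (0 : EuclideanSpace ℝ (Fin 4)) 1)
/-- Local notation: the unit circle `S¹ ⊂ ℂ`. -/
local notation "S1" => (Metric.sphere (0 : EuclideanSpace ℝ (Fin 2)) 1)

attribute [local instance] Literature.Topology.FourManifolds.fact_finrank_euclideanSpace_succ

/-! ### `ℝ² ≅ ℂ` and the complex product of the two coordinates -/

/-- **`ℝ² ≅ ℂ`** (the inverse of Mathlib's `Complex.orthonormalBasisOneI.repr`): `(a₀, a₁) ↦ a₀ + a₁ i`,
a linear isometry. [folklore] -/
def cIso : E2 ≃ₗᵢ[ℝ] ℂ :=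
  Complex.orthonormalBasisOneI.repr.symm

/-- `cIso (a₀, a₁) = a₀ + a₁ i`. [folklore] -/
theorem cIso_apply (a : E2) : cIso a = a 0 + a 1 * Complex.I :=
  Complex.orthonormalBasisOneI_repr_symm_apply a

/-- `cIso` is the tree's coordinate map `Literature.Topology.FourManifolds.toC` (`TorusCoordinates.lean`,
a bare function `v ↦ ⟨v₀, v₁⟩`), here bundled as a linear isometry equivalence so that linearity,
smoothness and the inverse are available. [folklore] -/
theorem cIso_eq_toC (a : E2) : cIso a = Literature.Topology.FourManifolds.toC a :=
  (toC_eq_orthonormalBasisOneI_repr_symm a).symm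

/-- `re (cIso a) = a₀`. [folklore] -/
@[simp] theorem re_cIso (a : E2) : (cIso a).re = a 0 := by
  simp [cIso_apply]

/-- `im (cIso a) = a₁`. [folklore] -/
@[simp] theorem im_cIso (a : E2) : (cIso a).im = a 1 := by
  simp [cIso_apply]

/-- `(cIso⁻¹ z)₀ = re z`. [folklore] -/
@[simp] theorem cIso_symm_apply_zero (z : ℂ) : cIso.symm z 0 = z.re := by
  have h : cIso.symm z = Complex.orthonormalBasisOneI.repr z := rfl
  rw [h, Complex.orthonormalBasisOneI_repr_apply]
  rfl

/-- `(cIso⁻¹ z)₁ = im z`. [folklore] -/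
@[simp] theorem cIso_symm_apply_one (z : ℂ) : cIso.symm z 1 = z.im := by
  have h : cIso.symm z = Complex.orthonormalBasisOneI.repr z := rfl
  rw [h, Complex.orthonormalBasisOneI_repr_apply]
  rfl

/-- `cIso` preserves norms. [folklore] -/
@[simp] theorem norm_cIso (a : E2) : ‖cIso a‖ = ‖a‖ :=
  cIso.norm_map a

/-- `cIso⁻¹` preserves norms. [folklore] -/
@[simp] theorem norm_cIso_symm (z : ℂ) : ‖cIso.symm z‖ = ‖z‖ :=
  cIso.symm.norm_map z

/-- `cIso a = 0 ↔ a = 0`. [folklore] -/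
theorem cIso_eq_zero_iff (a : E2) : cIso a = 0 ↔ a = 0 :=
  cIso.toLinearEquiv.map_eq_zero_iff

/-- On the unit circle, `cIso p` is a unit complex number: `normSq (cIso p) = 1`. [folklore] -/
theorem normSq_cIso_sphere (p : S1) : Complex.normSq (cIso (p : E2)) = 1 := by
  rw [Complex.normSq_eq_norm_sq, norm_cIso, norm_eq_of_mem_sphere p, one_pow]

/-- On the unit circle, `cIso p · conj (cIso p) = 1`. [folklore] -/
theorem cIso_mul_conj_sphere (p : S1) : cIso (p : E2) * conj (cIso (p : E2)) = 1 := by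
  rw [Complex.mul_conj, normSq_cIso_sphere, Complex.ofReal_one]

/-- On the unit circle, `conj (cIso p) · cIso p = 1`. [folklore] -/
theorem conj_mul_cIso_sphere (p : S1) : conj (cIso (p : E2)) * cIso (p : E2) = 1 := by
  rw [mul_comm, cIso_mul_conj_sphere]

/-- `cIso` is `C^∞`. [folklore] -/
theorem contDiff_cIso : ContDiff ℝ ∞ (cIso : E2 → ℂ) :=
  cIso.contDiff

/-- `cIso⁻¹` is `C^∞`. [folklore] -/
theorem contDiff_cIso_symm : ContDiff ℝ ∞ (cIso.symm : ℂ → E2) :=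
  cIso.symm.contDiff

/-- **The complex product `z₁ z₂` of the two complex coordinates of `x ∈ ℝ⁴ = ℂ²`.** [folklore] -/
def hmul (x : E4) : ℂ :=
  cIso (pr₁ x) * cIso (pr₂ x)

/-- `z₁ z₂` read back in `ℝ²`. [folklore] -/
def mvec (x : E4) : E2 :=
  cIso.symm (hmul x)

/-- `cIso (mvec x) = z₁ z₂`. [folklore] -/
@[simp] theorem cIso_mvec (x : E4) : cIso (mvec x) = hmul x :=
  cIso.apply_symm_apply _

/-- `mvec x = 0 ↔ z₁ z₂ = 0`. [folklore] -/
theorem mvec_eq_zero_iff (x : E4) : mvec x = 0 ↔ hmul x = 0 := by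
  rw [mvec, LinearIsometryEquiv.map_eq_zero_iff]

/-- `‖mvec x‖ = ‖z₁ z₂‖`. [folklore] -/
theorem norm_mvec (x : E4) : ‖mvec x‖ = ‖hmul x‖ := by
  rw [mvec, norm_cIso_symm]

/-- `z₁ z₂ = 0 ↔ z₁ = 0 ∨ z₂ = 0`. [folklore] -/
theorem hmul_eq_zero_iff (x : E4) : hmul x = 0 ↔ pr₁ x = 0 ∨ pr₂ x = 0 := by
  rw [hmul, mul_eq_zero, cIso_eq_zero_iff, cIso_eq_zero_iff]

/-- `hmul` is `C^∞`. [folklore] -/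
theorem contDiff_hmul : ContDiff ℝ ∞ hmul :=
  (contDiff_cIso.comp pr₁.contDiff).mul (contDiff_cIso.comp pr₂.contDiff)

/-- `mvec` is `C^∞`. [folklore] -/
theorem contDiff_mvec : ContDiff ℝ ∞ mvec :=
  contDiff_cIso_symm.comp contDiff_hmul

/-! ### The twist `(p, w) ↦ (p, w p̄)` of `S¹ × ℝ²` -/

/-- `w ↦ w · conj c` read in `ℝ²`. [folklore] -/
def twistFun (c w : E2) : E2 :=
  cIso.symm (cIso w * conj (cIso c))

/-- `v ↦ v · c` read in `ℝ²`. [folklore] -/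
def untwistFun (c v : E2) : E2 :=
  cIso.symm (cIso v * cIso c)

/-- `cIso (twistFun c w) = cIso w · conj (cIso c)`. [folklore] -/
@[simp] theorem cIso_twistFun (c w : E2) : cIso (twistFun c w) = cIso w * conj (cIso c) :=
  cIso.apply_symm_apply _

/-- `cIso (untwistFun c v) = cIso v · cIso c`. [folklore] -/
@[simp] theorem cIso_untwistFun (c v : E2) : cIso (untwistFun c v) = cIso v * cIso c :=
  cIso.apply_symm_apply _

/-- On the unit circle the two maps are inverse: `(w c̄) c = w`. [folklore] -/
theorem untwistFun_twistFun (p : S1) (w : E2) : untwistFun (p : E2) (twistFun (p : E2) w) = w := by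
  apply cIso.injective
  rw [cIso_untwistFun, cIso_twistFun, mul_assoc, conj_mul_cIso_sphere, mul_one]

/-- On the unit circle the two maps are inverse: `(v c) c̄ = v`. [folklore] -/
theorem twistFun_untwistFun (p : S1) (v : E2) : twistFun (p : E2) (untwistFun (p : E2) v) = v := by
  apply cIso.injective
  rw [cIso_twistFun, cIso_untwistFun, mul_assoc, cIso_mul_conj_sphere, mul_one]

/-- The twist preserves norms (on the unit circle). [folklore] -/
@[simp] theorem norm_twistFun (p : S1) (w : E2) : ‖twistFun (p : E2) w‖ = ‖w‖ := by
  rw [← norm_cIso, cIso_twistFun, norm_mul, Complex.norm_conj, norm_cIso, norm_cIso,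
    norm_eq_of_mem_sphere p, mul_one]

/-- `twistFun p 0 = 0`. [folklore] -/
@[simp] theorem twistFun_zero (c : E2) : twistFun c 0 = 0 := by
  simp [twistFun]

/-- `twistFun p w = 0 ↔ w = 0` on the unit circle. [folklore] -/
theorem twistFun_eq_zero_iff (p : S1) (w : E2) : twistFun (p : E2) w = 0 ↔ w = 0 := by
  rw [← norm_eq_zero, norm_twistFun, norm_eq_zero]

/-- A real rescaling passes through the twist. [folklore] -/
theorem twistFun_smul (c : E2) (s : ℝ) (w : E2) : twistFun c (s • w) = s • twistFun c w := by
  apply cIso.injective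
  rw [cIso_twistFun, LinearIsometryEquiv.map_smul, LinearIsometryEquiv.map_smul, cIso_twistFun,
    Complex.real_smul, Complex.real_smul, mul_assoc]

/-- The twist is `C^∞` jointly in `(c, w)`. [folklore] -/
theorem contDiff_twistFun : ContDiff ℝ ∞ fun q : E2 × E2 => twistFun q.1 q.2 :=
  contDiff_cIso_symm.comp ((contDiff_cIso.comp contDiff_snd).mul
    (Complex.conjCLE.contDiff.comp (contDiff_cIso.comp contDiff_fst)))

/-- The untwist is `C^∞` jointly in `(c, v)`. [folklore] -/
theorem contDiff_untwistFun : ContDiff ℝ ∞ fun q : E2 × E2 => untwistFun q.1 q.2 :=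
  contDiff_cIso_symm.comp ((contDiff_cIso.comp contDiff_snd).mul (contDiff_cIso.comp contDiff_fst))

/-- **The twist of `S¹ × ℝ²`**: `(p, w) ↦ (p, w p̄)`. [folklore] -/
def twist (q : S1 × E2) : S1 × E2 :=
  (q.1, twistFun (q.1 : E2) q.2)

/-- The inverse twist `(p, v) ↦ (p, v p)`. [folklore] -/
def untwist (q : S1 × E2) : S1 × E2 :=
  (q.1, untwistFun (q.1 : E2) q.2)

/-- `untwist ∘ twist = id`. [folklore] -/
@[simp] theorem untwist_twist (q : S1 × E2) : untwist (twist q) = q := by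
  obtain ⟨p, w⟩ := q
  simp [twist, untwist, untwistFun_twistFun]

/-- `twist ∘ untwist = id`. [folklore] -/
@[simp] theorem twist_untwist (q : S1 × E2) : twist (untwist q) = q := by
  obtain ⟨p, v⟩ := q
  simp [twist, untwist, twistFun_untwistFun]

/-- The second component of the twist is `C^∞` (the pattern of `SphereOpenBook.contMDiff_tube`:
a `C^∞` map of `ℝ² × ℝ²` after `(p, w) ↦ (p, w)`, `prodMk_space`). [folklore] -/
theorem contMDiff_twist_snd :
    ContMDiff ((𝓡 1).prod 𝓘(ℝ, E2)) 𝓘(ℝ, E2) ∞ fun q : S1 × E2 => twistFun (q.1 : E2) q.2 := by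
  -- elaborated bottom-up (`have` without expected type): unifying `ContMDiff.comp` against the
  -- `fun`-statement directly makes the elaborator time out
  have h1 : ContMDiff ((𝓡 1).prod 𝓘(ℝ, E2)) 𝓘(ℝ, E2 × E2) ∞ fun q : S1 × E2 => ((q.1 : E2), q.2) :=
    ((contMDiff_coe_sphere (n := 1)).comp contMDiff_fst).prodMk_space contMDiff_snd
  have h := contDiff_twistFun.contMDiff.comp h1
  exact h

/-- The second component of the untwist is `C^∞`. [folklore] -/
theorem contMDiff_untwist_snd :
    ContMDiff ((𝓡 1).prod 𝓘(ℝ, E2)) 𝓘(ℝ, E2) ∞ fun q : S1 × E2 => untwistFun (q.1 : E2) q.2 := by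
  have h1 : ContMDiff ((𝓡 1).prod 𝓘(ℝ, E2)) 𝓘(ℝ, E2 × E2) ∞ fun q : S1 × E2 => ((q.1 : E2), q.2) :=
    ((contMDiff_coe_sphere (n := 1)).comp contMDiff_fst).prodMk_space contMDiff_snd
  have h := contDiff_untwistFun.contMDiff.comp h1
  exact h

/-- The twist is `C^∞`. [folklore] -/
theorem contMDiff_twist : ContMDiff ((𝓡 1).prod 𝓘(ℝ, E2)) ((𝓡 1).prod 𝓘(ℝ, E2)) ∞ twist := by
  unfold twist
  exact contMDiff_fst.prodMk contMDiff_twist_snd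

/-- The untwist is `C^∞`. [folklore] -/
theorem contMDiff_untwist : ContMDiff ((𝓡 1).prod 𝓘(ℝ, E2)) ((𝓡 1).prod 𝓘(ℝ, E2)) ∞ untwist := by
  unfold untwist
  exact contMDiff_fst.prodMk contMDiff_untwist_snd

/-- The twist is onto. [folklore] -/
theorem surjective_twist : Surjective twist :=
  HasRightInverse.surjective ⟨untwist, twist_untwist⟩

/-- The twist as a homeomorphism of `S¹ × ℝ²`. [folklore] -/
def twistHomeo : (S1 × E2) ≃ₜ (S1 × E2) where
  toFun := twist
  invFun := untwist
  left_inv := untwist_twist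
  right_inv := twist_untwist
  continuous_toFun := contMDiff_twist.continuous
  continuous_invFun := contMDiff_untwist.continuous

/-- The twist is injective. [folklore] -/
theorem injective_twist : Injective twist :=
  twistHomeo.injective

/-- The twist is an open map. [folklore] -/
theorem isOpenMap_twist : IsOpenMap twist :=
  twistHomeo.isOpenMap

/-! ### The swap `(z₁, z₂) ↦ (z₂, z₁)` of `S³` -/

/-- The swap of the two complex coordinates of `ℝ⁴ = ℂ²`. [folklore] -/
def swapAmb : E4 →L[ℝ] E4 :=
  join.comp (pr₂.prod pr₁)

/-- `z₁ ∘ swap = z₂`. [folklore] -/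
@[simp] theorem pr₁_swapAmb (x : E4) : pr₁ (swapAmb x) = pr₂ x := by
  simp [swapAmb]

/-- `z₂ ∘ swap = z₁`. [folklore] -/
@[simp] theorem pr₂_swapAmb (x : E4) : pr₂ (swapAmb x) = pr₁ x := by
  simp [swapAmb]

/-- The swap is an involution. [folklore] -/
@[simp] theorem swapAmb_swapAmb (x : E4) : swapAmb (swapAmb x) = x := by
  have h : swapAmb (swapAmb x) = join (pr₁ x, pr₂ x) := by
    simp [swapAmb]
  rw [h, join_pr]

/-- The swap preserves norms. [folklore] -/
theorem norm_swapAmb (x : E4) : ‖swapAmb x‖ = ‖x‖ := by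
  have h : ‖swapAmb x‖ ^ 2 = ‖x‖ ^ 2 := by
    rw [norm_sq_eq_add (swapAmb x), pr₁_swapAmb, pr₂_swapAmb, norm_sq_eq_add x, add_comm]
  exact (sq_eq_sq₀ (norm_nonneg _) (norm_nonneg _)).1 h

/-- The swap of a point of `S³` lies on `S³`. [folklore] -/
theorem swapAmb_mem (z : S3) : swapAmb (z : E4) ∈ S3 := by
  rw [mem_sphere_zero_iff_norm, norm_swapAmb, norm_eq_of_mem_sphere z]

/-- **The swap `(z₁, z₂) ↦ (z₂, z₁)` of `S³`.** [folklore] -/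
def swapS : S3 → S3 :=
  Set.codRestrict (fun z : S3 => swapAmb (z : E4)) _ swapAmb_mem

/-- The swap read in `ℝ⁴`. [folklore] -/
@[simp] theorem coe_swapS (z : S3) : (swapS z : E4) = swapAmb (z : E4) := rfl

/-- The swap of `S³` is an involution. [folklore] -/
@[simp] theorem swapS_swapS (z : S3) : swapS (swapS z) = z :=
  Subtype.ext (by simp)

/-- The swap of `S³` is `C^∞`. [folklore] -/
theorem contMDiff_swapS : ContMDiff (𝓡 3) (𝓡 3) ∞ swapS :=
  (swapAmb.contDiff.contMDiff.comp (contMDiff_coe_sphere (n := 3))).codRestrict_sphere _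

/-- The swap as a homeomorphism of `S³`. [folklore] -/
def swapHomeo : S3 ≃ₜ S3 where
  toFun := swapS
  invFun := swapS
  left_inv := swapS_swapS
  right_inv := swapS_swapS
  continuous_toFun := contMDiff_swapS.continuous
  continuous_invFun := contMDiff_swapS.continuous

/-- The swap of `S³` is injective. [folklore] -/
theorem injective_swapS : Injective swapS :=
  swapHomeo.injective

/-! ### The two binding tubes -/

/-- **The tube around the binding component `{z₁ = 0}`**: `(p, w) ↦ (w p̄, p)/√(1 + ‖w‖²)`, i.e.
the standard tube of `SphereOpenBookForm.lean` precomposed with the twist. [folklore] -/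
def tube₁ : S1 × E2 → S3 :=
  tube ∘ twist

/-- **The tube around the binding component `{z₂ = 0}`**: `(p, w) ↦ (p, w p̄)/√(1 + ‖w‖²)`, the
swap of `tube₁`. [folklore] -/
def tube₂ : S1 × E2 → S3 :=
  swapS ∘ tube₁

/-- The rescaling factor is twist invariant. [folklore] -/
@[simp] theorem tubeScale_twistFun (p : S1) (w : E2) : tubeScale (twistFun (p : E2) w) = tubeScale w := by
  rw [tubeScale, tubeScale, norm_twistFun]

/-- `z₁ (tube₁ (p, w)) = s(w) · (w p̄)`. [folklore] -/
theorem pr₁_tube₁ (p : S1) (w : E2) :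
    pr₁ (tube₁ (p, w) : E4) = tubeScale w • twistFun (p : E2) w := by
  change pr₁ (tube (p, twistFun (p : E2) w) : E4) = _
  rw [pr₁_tube, tubeScale_twistFun]

/-- `z₂ (tube₁ (p, w)) = s(w) · p`. [folklore] -/
theorem pr₂_tube₁ (p : S1) (w : E2) : pr₂ (tube₁ (p, w) : E4) = tubeScale w • (p : E2) := by
  change pr₂ (tube (p, twistFun (p : E2) w) : E4) = _
  rw [pr₂_tube, tubeScale_twistFun]

/-- `z₁ (tube₂ (p, w)) = s(w) · p`. [folklore] -/
theorem pr₁_tube₂ (p : S1) (w : E2) : pr₁ (tube₂ (p, w) : E4) = tubeScale w • (p : E2) := by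
  change pr₁ (swapAmb (tube₁ (p, w) : E4)) = _
  rw [pr₁_swapAmb, pr₂_tube₁]

/-- `z₂ (tube₂ (p, w)) = s(w) · (w p̄)`. [folklore] -/
theorem pr₂_tube₂ (p : S1) (w : E2) :
    pr₂ (tube₂ (p, w) : E4) = tubeScale w • twistFun (p : E2) w := by
  change pr₂ (swapAmb (tube₁ (p, w) : E4)) = _
  rw [pr₂_swapAmb, pr₁_tube₁]

/-- The core of `tube₁` is `p ↦ (0, p)`, the circle `{z₁ = 0}`. [folklore] -/
theorem coe_tube₁_zero (p : S1) : (tube₁ (p, 0) : E4) = join (0, (p : E2)) := by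
  change (tube (p, twistFun (p : E2) 0) : E4) = _
  rw [twistFun_zero, coe_tube_zero]

/-- The core of `tube₂` is `p ↦ (p, 0)`, the circle `{z₂ = 0}`. [folklore] -/
theorem coe_tube₂_zero (p : S1) : (tube₂ (p, 0) : E4) = join ((p : E2), 0) := by
  change swapAmb (tube₁ (p, 0) : E4) = _
  rw [coe_tube₁_zero]
  simp [swapAmb]

/-- `tube₁` is `C^∞`. [folklore] -/
theorem contMDiff_tube₁ : ContMDiff ((𝓡 1).prod 𝓘(ℝ, E2)) (𝓡 3) ∞ tube₁ :=
  contMDiff_tube.comp contMDiff_twist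

/-- `tube₂` is `C^∞`. [folklore] -/
theorem contMDiff_tube₂ : ContMDiff ((𝓡 1).prod 𝓘(ℝ, E2)) (𝓡 3) ∞ tube₂ :=
  contMDiff_swapS.comp contMDiff_tube₁

/-- The range of `tube₁` is `{z₂ ≠ 0}` (that of the standard tube, the twist being onto).
[folklore] -/
theorem range_tube₁ : range tube₁ = {z : S3 | pr₂ (z : E4) ≠ 0} := by
  rw [tube₁, range_comp, surjective_twist.range_eq, image_univ, range_tube]

/-- The range of `tube₂` is `{z₁ ≠ 0}`. [folklore] -/
theorem range_tube₂ : range tube₂ = {z : S3 | pr₁ (z : E4) ≠ 0} := by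
  rw [tube₂, range_comp, range_tube₁]
  ext z
  constructor
  · rintro ⟨y, hy, rfl⟩
    simpa using hy
  · intro hz
    exact ⟨swapS z, by simpa using hz, swapS_swapS z⟩

/-- **`tube₁` is a `C^∞` embedding** (a reparametrisation of the standard tube by the twist,
`isSmoothEmbedding_comp_of_inverse`). [folklore] -/
theorem isSmoothEmbedding_tube₁ : Manifold.IsSmoothEmbedding ((𝓡 1).prod 𝓘(ℝ, E2)) (𝓡 3) ∞ tube₁ := by
  haveI : Nonempty (S1 × E2) := ⟨(Literature.Topology.FourManifolds.circlePt 0, 0)⟩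
  exact (Literature.Geometry.Manifold.isSmoothEmbedding_comp_of_inverse isSmoothEmbedding_tube
    isOpen_range_tube contMDiff_twist injective_twist isOpenMap_twist contMDiff_untwist.contMDiffOn
    untwist_twist modelEquiv).1

/-- The range of `tube₁` is open. [folklore] -/
theorem isOpen_range_tube₁ : IsOpen (range tube₁) := by
  rw [range_tube₁]
  exact isOpen_ne.preimage (pr₂.continuous.comp continuous_subtype_val)

/-- The range of `tube₂` is open. [folklore] -/
theorem isOpen_range_tube₂ : IsOpen (range tube₂) := by
  rw [range_tube₂]
  exact isOpen_ne.preimage (pr₁.continuous.comp continuous_subtype_val)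

/-- `tube₁` is injective. [folklore] -/
theorem injective_tube₁ : Injective tube₁ :=
  injective_tube.comp injective_twist

/-- `tube₂` is injective. [folklore] -/
theorem injective_tube₂ : Injective tube₂ :=
  injective_swapS.comp injective_tube₁

/-- The explicit inverse of `tube₁` on its range: untwist the inverse of the standard tube.
[folklore] -/
def tube₁Inv : S3 → S1 × E2 :=
  untwist ∘ tubeInv

/-- `tube₁Inv ∘ tube₁ = id`. [folklore] -/
@[simp] theorem tube₁Inv_tube₁ (q : S1 × E2) : tube₁Inv (tube₁ q) = q := by
  simp [tube₁Inv, tube₁, tubeInv_tube]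

/-- `tube₁Inv` is `C^∞` on `{z₂ ≠ 0}`. [folklore] -/
theorem contMDiffOn_tube₁Inv : ContMDiffOn (𝓡 3) ((𝓡 1).prod 𝓘(ℝ, E2)) ∞ tube₁Inv (range tube) :=
  contMDiff_untwist.comp_contMDiffOn contMDiffOn_tubeInv

/-- `tube₁` is an open map. [folklore] -/
theorem isOpenMap_tube₁ : IsOpenMap tube₁ :=
  Literature.Geometry.Manifold.isOpenMap_of_isSmoothEmbedding_of_isOpen_range
    isSmoothEmbedding_tube₁ isOpen_range_tube₁

/-- **`tube₂` is a `C^∞` embedding** (injective open `C^∞` map with the `C^∞` left inverse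
`tube₁Inv ∘ swap` on its range). [folklore] -/
theorem isSmoothEmbedding_tube₂ : Manifold.IsSmoothEmbedding ((𝓡 1).prod 𝓘(ℝ, E2)) (𝓡 3) ∞ tube₂ := by
  refine (Literature.Geometry.Manifold.isSmoothEmbedding_of_leftInverse_of_isOpenMap contMDiff_tube₂
    injective_tube₂ (swapHomeo.isOpenMap.comp isOpenMap_tube₁) (finv := tube₁Inv ∘ swapS) ?_
    (fun q => ?_) modelEquiv).1
  · rw [range_tube₂]
    refine contMDiffOn_tube₁Inv.comp contMDiff_swapS.contMDiffOn fun z hz => ?_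
    rw [range_tube]
    simpa using hz
  · change tube₁Inv (swapS (swapS (tube₁ q))) = q
    rw [swapS_swapS, tube₁Inv_tube₁]

/-! ### The tube family, its binding, and the normal form of `z₁z₂` in the tubes -/

/-- **The tube family of the Hopf open book** (`0 ↦ tube₁`, `1 ↦ tube₂`). [folklore] -/
def tubes : Fin 2 → S1 × E2 → S3 :=
  ![tube₁, tube₂]

/-- `tubes 0 = tube₁`. [folklore] -/
@[simp] theorem tubes_zero : tubes 0 = tube₁ := rfl

/-- `tubes 1 = tube₂`. [folklore] -/
@[simp] theorem tubes_one : tubes 1 = tube₂ := rfl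

/-- Points with `z₂ = 0` have `‖z₁‖ = 1`. [folklore] -/
theorem norm_pr₁_of_pr₂_eq_zero {z : S3} (hz : pr₂ (z : E4) = 0) : ‖pr₁ (z : E4)‖ = 1 := by
  have h := norm_sq_pr_add z
  rw [hz, norm_zero, zero_pow two_ne_zero, add_zero] at h
  exact (pow_eq_one_iff_of_nonneg (norm_nonneg _) two_ne_zero).1 h

/-- **The binding of the Hopf tube family is the Hopf link `{z₁ z₂ = 0}`.** [folklore] -/
theorem tubesBinding_eq : tubesBinding tubes = {z : S3 | hmul (z : E4) = 0} := by
  ext z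
  rw [mem_tubesBinding_iff, mem_setOf_eq, hmul_eq_zero_iff]
  constructor
  · rintro ⟨i, p, rfl⟩
    fin_cases i
    · left
      change pr₁ (tube₁ (p, 0) : E4) = 0
      rw [coe_tube₁_zero, pr₁_join]
    · right
      change pr₂ (tube₂ (p, 0) : E4) = 0
      rw [coe_tube₂_zero, pr₂_join]
  · rintro (hz | hz)
    · refine ⟨0, ⟨pr₂ (z : E4), mem_sphere_zero_iff_norm.2 (norm_pr₂_of_pr₁_eq_zero hz)⟩, ?_⟩
      apply Subtype.ext
      change (tube₁ (_, 0) : E4) = z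
      rw [coe_tube₁_zero]
      conv_rhs => rw [← join_pr (z : E4)]
      rw [hz]
    · refine ⟨1, ⟨pr₁ (z : E4), mem_sphere_zero_iff_norm.2 (norm_pr₁_of_pr₂_eq_zero hz)⟩, ?_⟩
      apply Subtype.ext
      change (tube₂ (_, 0) : E4) = z
      rw [coe_tube₂_zero]
      conv_rhs => rw [← join_pr (z : E4)]
      rw [hz]

/-- A real rescaling read in `ℂ`: `cIso (s • a) = s · cIso a`. [folklore] -/
theorem cIso_smul (s : ℝ) (a : E2) : cIso (s • a) = (s : ℂ) * cIso a := by
  rw [LinearIsometryEquiv.map_smul, Complex.real_smul]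

/-- **Normal form of `z₁ z₂` in `tube₁`**: `z₁z₂ (tube₁ (p, w)) = s(w)² w`. [folklore] -/
theorem mvec_tube₁ (p : S1) (w : E2) : mvec (tube₁ (p, w) : E4) = (tubeScale w ^ 2) • w := by
  apply cIso.injective
  rw [cIso_mvec, hmul, pr₁_tube₁, pr₂_tube₁, cIso_smul, cIso_smul, cIso_twistFun, cIso_smul,
    Complex.ofReal_pow]
  have h := conj_mul_cIso_sphere p
  linear_combination (↑(tubeScale w) : ℂ) ^ 2 * cIso w * h

/-- **Normal form of `z₁ z₂` in `tube₂`**: `z₁z₂ (tube₂ (p, w)) = s(w)² w`. [folklore] -/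
theorem mvec_tube₂ (p : S1) (w : E2) : mvec (tube₂ (p, w) : E4) = (tubeScale w ^ 2) • w := by
  apply cIso.injective
  rw [cIso_mvec, hmul, pr₁_tube₂, pr₂_tube₂, cIso_smul, cIso_smul, cIso_twistFun, cIso_smul,
    Complex.ofReal_pow]
  have h := conj_mul_cIso_sphere p
  linear_combination (↑(tubeScale w) : ℂ) ^ 2 * cIso w * h

/-- The normal form for the family: `z₁z₂ (tubes i (p, w)) = s(w)² w`. [folklore] -/
theorem mvec_tubes (i : Fin 2) (p : S1) (w : E2) :
    mvec (tubes i (p, w) : E4) = (tubeScale w ^ 2) • w := by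
  fin_cases i
  · exact mvec_tube₁ p w
  · exact mvec_tube₂ p w

/-- The binding meets each tube exactly in its core. [folklore] -/
theorem eq_zero_of_tubes_eq (i j : Fin 2) (x y : S1) (w : E2) (h : tubes i (x, w) = tubes j (y, 0)) :
    w = 0 := by
  have hb : tubes i (x, w) ∈ tubesBinding tubes := (mem_tubesBinding_iff _ _).2 ⟨j, y, h.symm⟩
  rw [tubesBinding_eq, mem_setOf_eq, ← mvec_eq_zero_iff, mvec_tubes] at hb
  exact (smul_eq_zero.1 hb).resolve_left (pow_ne_zero 2 (tubeScale_pos w).ne')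

/-! ### The fibration `π = z₁z₂/‖z₁z₂‖` -/

/-- **The fibration `π : S³ → S¹`, `π(z) = z₁z₂/‖z₁z₂‖`** (junk on the Hopf link). [folklore] -/
def proj (z : S3) : S1 :=
  RotationBody.sphN (m := 1) (mvec (z : E4))

/-- Normal form: `π (tubes i (p, w)) = w/‖w‖` for `w ≠ 0`. [folklore] -/
theorem coe_proj_tubes (i : Fin 2) (p : S1) {w : E2} (hw : w ≠ 0) :
    ((proj (tubes i (p, w)) : S1) : E2) = ‖w‖⁻¹ • w := by
  rw [proj, mvec_tubes, RotationBody.sphN_smul (pow_pos (tubeScale_pos w) 2) hw,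
    RotationBody.coe_sphN hw]

/-- `z ↦ z₁z₂` (in `ℝ²`) is `C^∞` on `S³`. [folklore] -/
theorem contMDiff_mvec : ContMDiff (𝓡 3) 𝓘(ℝ, E2) ∞ fun z : S3 => mvec (z : E4) :=
  contDiff_mvec.contMDiff.comp (contMDiff_coe_sphere (n := 3))

/-- `π` is `C^∞` off the Hopf link. [folklore] -/
theorem contMDiffOn_proj : ContMDiffOn (𝓡 3) (𝓡 1) ∞ proj {z : S3 | hmul (z : E4) ≠ 0} :=
  RotationBody.contMDiffOn_sphN.comp contMDiff_mvec.contMDiffOn fun z hz => by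
    change mvec (z : E4) ≠ 0
    rwa [Ne, mvec_eq_zero_iff]

/-- `π` read in `ℝ²` is `sphFun ∘ mvec` (definitional). [folklore] -/
theorem coe_proj_eq : (fun z : S3 => ((proj z : S1) : E2)) =
    (RotationBody.sphFun ∘ mvec) ∘ (Subtype.val : S3 → E4) :=
  rfl

/-- **The angular differential of `π` at `y` off the Hopf link** in terms of any Fréchet
derivative `M'` of `mvec` at `y`: `dθ_y(n) = (m₀ (M'N)₁ - m₁ (M'N)₀)/‖m‖²`, `m = z₁z₂(y)`,
`N = D_y n`. [folklore] -/
theorem angularDeriv_proj {y : S3} (hy : hmul (y : E4) ≠ 0) {M' : E4 →L[ℝ] E2}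
    (hM : HasFDerivAt mvec M' (y : E4)) (n : E3) :
    angularDeriv proj y n =
      (‖mvec (y : E4)‖ ^ 2)⁻¹ *
        (mvec (y : E4) 0 * M' (D y n) 1 - mvec (y : E4) 1 * M' (D y n) 0) := by
  have hy' : mvec (y : E4) ≠ 0 := by rwa [Ne, mvec_eq_zero_iff]
  obtain ⟨ℓ, hℓ⟩ := hasFDerivAt_normalize hy'
  set L : E2 →L[ℝ] E2 :=
    ‖mvec (y : E4)‖⁻¹ • ContinuousLinearMap.id ℝ E2 + ℓ.smulRight (mvec (y : E4)) with hL
  have hg : HasFDerivAt (RotationBody.sphFun ∘ mvec) (L.comp M') (y : E4) :=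
    (hℓ.congr_of_eventuallyEq (sphFun_eventuallyEq hy')).comp (y : E4) hM
  have hgm : HasMFDerivAt 𝓘(ℝ, E4) 𝓘(ℝ, E2) (RotationBody.sphFun ∘ mvec) (y : E4) (L.comp M') :=
    hasMFDerivAt_iff_hasFDerivAt.2 hg
  have hcomp := hgm.comp y (hasMFDerivAt_val y)
  rw [angularDeriv_apply, coe_proj_eq, hcomp.mfderiv]
  have hp : ((proj y : S1) : E2) = ‖mvec (y : E4)‖⁻¹ • mvec (y : E4) := RotationBody.coe_sphN hy'
  rw [hp]
  change angleForm (‖mvec (y : E4)‖⁻¹ • mvec (y : E4)) (L (M' (D y n))) = _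
  rw [hL]
  change angleForm (‖mvec (y : E4)‖⁻¹ • mvec (y : E4))
      (‖mvec (y : E4)‖⁻¹ • M' (D y n) + ℓ (M' (D y n)) • mvec (y : E4)) = _
  rw [angleForm_normalize]

/-- **A Fréchet derivative of `mvec = cIso⁻¹ ∘ (z₁ · z₂)`** (product rule): at `y`, in the
direction `v`, it is `cIso⁻¹ (z₁(y) z₂(v) + z₂(y) z₁(v))`. [folklore] -/
theorem hasFDerivAt_mvec (y : E4) :
    HasFDerivAt mvec
      ((cIso.symm : ℂ →L[ℝ] E2).comp
        (cIso (pr₁ y) • ((cIso : E2 →L[ℝ] ℂ).comp pr₂) + cIso (pr₂ y) • ((cIso : E2 →L[ℝ] ℂ).comp pr₁)))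
      y := by
  have h1 : HasFDerivAt (fun x : E4 => cIso (pr₁ x)) ((cIso : E2 →L[ℝ] ℂ).comp pr₁) y :=
    (cIso : E2 →L[ℝ] ℂ).hasFDerivAt.comp y pr₁.hasFDerivAt
  have h2 : HasFDerivAt (fun x : E4 => cIso (pr₂ x)) ((cIso : E2 →L[ℝ] ℂ).comp pr₂) y :=
    (cIso : E2 →L[ℝ] ℂ).hasFDerivAt.comp y pr₂.hasFDerivAt
  have hm : HasFDerivAt hmul
      (cIso (pr₁ y) • ((cIso : E2 →L[ℝ] ℂ).comp pr₂) + cIso (pr₂ y) • ((cIso : E2 →L[ℝ] ℂ).comp pr₁)) y :=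
    h1.mul h2
  exact (cIso.symm : ℂ →L[ℝ] E2).hasFDerivAt.comp y hm

/-- The ambient vector `(-y₁, y₀, 0, 0) = (i z₁, 0)` is tangent to `S³` at `y` (reused from the
standard open book: `rotVec`, `inner_rotVec`); `z₁` of it is `i z₁(y)`. [folklore] -/
theorem cIso_pr₁_rotVec (y : E4) : cIso (pr₁ (rotVec y)) = Complex.I * cIso (pr₁ y) := by
  apply Complex.ext
  · simp [rotVec, cIso_apply]
  · simp [rotVec, cIso_apply]

/-- `z₂` of the rotation vector vanishes. [folklore] -/
theorem pr₂_rotVec (y : E4) : pr₂ (rotVec y) = 0 := by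
  ext i
  fin_cases i <;> simp [rotVec]

/-- **`π` is a submersion off the Hopf link**: `dθ_y ≠ 0` for `z₁z₂(y) ≠ 0` (it takes the value
`1` on the rotation vector `(i z₁, 0)`, along which `z₁z₂` turns at unit angular speed). [folklore] -/
theorem angularDeriv_proj_ne_zero {y : S3} (hy : hmul (y : E4) ≠ 0) : angularDeriv proj y ≠ 0 := by
  obtain ⟨n, hn⟩ := exists_D_eq y (inner_rotVec (y : E4))
  have hy' : mvec (y : E4) ≠ 0 := by rwa [Ne, mvec_eq_zero_iff]
  have hr : 0 < ‖mvec (y : E4)‖ ^ 2 := by positivity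
  -- the derivative of `mvec` on the rotation vector is `i · z₁z₂`, i.e. `mvec` turned by `90°`
  set M' : E4 →L[ℝ] E2 := (cIso.symm : ℂ →L[ℝ] E2).comp
    (cIso (pr₁ (y : E4)) • ((cIso : E2 →L[ℝ] ℂ).comp pr₂) +
      cIso (pr₂ (y : E4)) • ((cIso : E2 →L[ℝ] ℂ).comp pr₁)) with hM'
  have hrot : M' (rotVec (y : E4)) = cIso.symm (Complex.I * hmul (y : E4)) := by
    rw [hM']
    change cIso.symm (cIso (pr₁ (y : E4)) * cIso (pr₂ (rotVec (y : E4))) +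
      cIso (pr₂ (y : E4)) * cIso (pr₁ (rotVec (y : E4)))) = _
    rw [pr₂_rotVec, map_zero, mul_zero, zero_add, cIso_pr₁_rotVec, hmul]
    ring_nf
  have h0 : M' (rotVec (y : E4)) 0 = -(mvec (y : E4) 1) := by
    rw [hrot, cIso_symm_apply_zero, mvec, cIso_symm_apply_one, Complex.mul_re, Complex.I_re,
      Complex.I_im]
    ring
  have h1 : M' (rotVec (y : E4)) 1 = mvec (y : E4) 0 := by
    rw [hrot, cIso_symm_apply_one, mvec, cIso_symm_apply_zero, Complex.mul_im, Complex.I_re,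
      Complex.I_im]
    ring
  have hval : angularDeriv proj y n = 1 := by
    rw [angularDeriv_proj hy (hasFDerivAt_mvec (y : E4)) n, hn, ← hM', h0, h1, norm_sq_eq₂]
    rw [mul_neg, sub_neg_eq_add, inv_mul_cancel₀]
    rw [norm_sq_eq₂] at hr
    exact hr.ne'
  intro h
  rw [h] at hval
  exact zero_ne_one hval

/-! ### The Hopf open book -/

/-- **THE POSITIVE HOPF OPEN BOOK OF `S³`**: binding the Hopf link `{z₁ = 0} ∪ {z₂ = 0}` with its
two tubes, fibration `π = z₁z₂/‖z₁z₂‖`, pages the open annuli `{z₁z₂ ∈ ℝ₊ c}` (Etnyre 2006, §2,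
Example: the open book of the positive Hopf link `H⁺`, the Milnor fibration of `z₁z₂`; monodromy
a right-handed Dehn twist). [cite: Etnyre2006, §2, Example: the positive Hopf link H⁺ and Milnor fibrations] -/
def hopfOpenBook : OpenBook S3 where
  k := 2
  k_pos := two_pos
  tube := tubes
  proj := proj
  isSmoothEmbedding_tube := fun i => by
    fin_cases i
    · exact isSmoothEmbedding_tube₁
    · exact isSmoothEmbedding_tube₂
  isOpen_range_tube := fun i => by
    fin_cases i
    · exact isOpen_range_tube₁
    · exact isOpen_range_tube₂
  eq_zero_of_tube_eq := fun i j x y w h => eq_zero_of_tubes_eq i j x y w h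
  proj_tube := fun i x _ hw => coe_proj_tubes i x hw
  contMDiffOn_proj := by
    rw [tubesBinding_eq]
    exact contMDiffOn_proj
  angularDeriv_ne_zero := fun y hy => by
    rw [tubesBinding_eq] at hy
    exact angularDeriv_proj_ne_zero hy

/-- The binding of the Hopf open book is the Hopf link `{z₁z₂ = 0}`. [folklore] -/
theorem binding_hopfOpenBook : hopfOpenBook.binding = {z : S3 | hmul (z : E4) = 0} :=
  tubesBinding_eq

/-- `y ∉ B ↔ z₁z₂(y) ≠ 0`. [folklore] -/
theorem not_mem_binding_iff (y : S3) : y ∉ hopfOpenBook.binding ↔ hmul (y : E4) ≠ 0 := by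
  rw [binding_hopfOpenBook]
  rfl

/-- **The pages of the Hopf open book**: `y` lies on the page over `c` iff `z₁z₂(y) ≠ 0` and
`z₁z₂(y)/‖z₁z₂(y)‖ = c`. [folklore] -/
theorem mem_page_iff (c : S1) (y : S3) :
    y ∈ hopfOpenBook.page c ↔ hmul (y : E4) ≠ 0 ∧ RotationBody.sphN (m := 1) (mvec (y : E4)) = c := by
  rw [OpenBook.mem_page_iff, not_mem_binding_iff]
  rfl

end HopfOpenBook

end Literature.Geometry.Symplectic
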